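import Literature.NumberTheory.Connes2026.SeparatedSincHS
import Literature.NumberTheory.Connes2026.ScalingOpRiemannLebesgue
import Literature.Analysis.OperatorTheory.KernelRankOneExpansion
import HarnessLib

/-!
# The separated sinc operator `(1 − Q̃) P̂⁰_M Q₀` is NUCLEAR, uniformly in `M`: an explicit rank-one expansion
# `(1 − Q̃) P̂⁰_M Q₀ = Σ_k λ_k |u_k^M⟩⟨w_k^M|` with modulated vectors `u_k^M = e^{2πiσ_kM·} u_k`, `w_k^M = e^{2πiσ_kM·} w_k`
# and `Σ_k |λ_k| (‖u_k‖² + ‖w_k‖²) < ∞` independent of `M`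

LABEL (line 1): RH-FREE literature (theorems only; NO definition, NO named fact).  bears_on: LADDER-RH
W-C/W-P (C1 named-fact debt), cell `rh-crit`, sub-cell cc, overflow row O1 — step (iv-a) of the separated
remainder estimate (S1,S0,S2) of the "annulus road" under `Connes1999_thm_VII_4_rat`.  WHAT THIS IS NOT: any
claim about positivity, Weil's criterion or RH.

Sources.  A. Connes, Selecta Math. 5 (1999) [`Connes1999`], §VII eq. (13) and proof of Thm 4 (29)–(33)
(held text `paper:arxiv-math_9811068`, p0013); A. Connes, C. Consani (2021) [`ConnesConsani2021`], §4 eq.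
(prolateeq) (the sinc kernel); M. Reed, B. Simon I (1972) [`ReedSimon1972`], Thm. VI.23 (kernel operators).

## The expansion

With `Q₀ = Q_{1/p,1}`, `Q̃ = Q_{e^{−δ}/p, e^{δ}}` (`δ > 0`), `s = e^{δ/2}`, the kernel of `(1 − Q̃) P̂⁰_M Q₀` is
`1_{x∉Q̃} sin(2πM(x−y))/(π(x−y)) 1_{y∈Q₀}` (`SeparatedSincKernel`); writing `sin(2πMv)/π = Σ_{σ=±1} (−σi/2π) e^{2πiσMv}`
and expanding `1/(x−y)` geometrically — `Σ_n y^n/x^{n+1}` on `|x| > e^δ ⊇`, `−Σ_n x^n/y^{n+1}` on `|x| ≤ e^{−δ}/p` —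
gives, over the index set `K = (ℕ ⊕ ℕ) ⊕ (ℕ ⊕ ℕ)` (sign `σ = ±1`; outer / inner region; `n`):
outer terms `λ = −σi/(2π)`, `u(x) = e^{2πiσMx} 1_{|x|>e^δ} (s/x)^n/x`, `w(y) = e^{2πiσMy} 1_{Q₀}(y) (y/s)^n`;
inner terms `λ = +σi/(2π)`, `u(x) = e^{2πiσMx} 1_{|x|≤e^{−δ}/p} (psx)^n`, `w(y) = e^{2πiσMy} 1_{Q₀}(y) ((psy)^n y)^{−1}`;
all four base families have `‖·‖² ≤ C e^{−δn}` (the balancing by `s` makes BOTH factors decay).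

## What is proved

* §1 `dilatedSinc_eq_cexp_add` (the sine as two exponentials), the term identities `outerTerm_eq`, `innerTerm_eq`;
* §2 `memLp_baseFamilies`, `norm_sq_baseFamilies_le` — square-integrability and the geometric norm bounds of
  the four base families;
* §3 `hasSum_sigmaPiece`, **`hasSum_separatedSinc_kernel`** — the POINTWISE expansion of the separated kernel
  over `K`;
* §4–§5 **`exists_rankOne_expansion_separatedSinc`** — the packaged OPERATOR expansion consumed by the
  (S1,S0,S2) assembly (via the tree's `hasSum_rankOne_of_kernel_expansion`: Fubini on `L²(ℝ²)` + dominated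
  convergence for the weak form, then the strong form): families `u w : ℝ → K → L²`, modulation data
  `(σ_k, u_k, w_k)`, `M`-free norms with `Σ_k |λ_k|(‖u_k‖² + ‖w_k‖²) < ∞`, and
  `(1 − Q̃)P̂⁰_MQ₀ φ = Σ_k λ_k ⟨w_k^M, φ⟩ u_k^M` for every `M > 0`.

No instance, notation or attribute; no `def`.
-/

noncomputable section

open _root_.MeasureTheory Complex Set Filter Function
open scoped Real Topology ComplexConjugate InnerProductSpace

namespace Literature.NumberTheory.Connes2026

open Literature.NumberTheory.LFunctions Literature.Analysis.OperatorTheory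
open Literature.NumberTheory.ConnesConsani
open Literature.NumberTheory.ConnesConsani2024
open Literature.NumberTheory.ConnesConsani2021 hiding cutoffProj cutoffProj_coeFn
open Literature.NumberTheory.DiophantineApproximation

/-! ## §1. The sine as two exponentials; the rank-one terms -/

/-- `e^{iθ} − e^{−iθ} = 2i sin θ`. [cite: Connes1999, §VII proof of Thm 4 eqs. (29)–(33) (arXiv p0013)] -/
theorem cexp_mul_I_sub_cexp_neg_mul_I (θ : ℂ) : cexp (θ * I) - cexp (-θ * I) = 2 * Complex.sin θ * I := by
  rw [Complex.exp_mul_I, Complex.exp_mul_I, Complex.cos_neg, Complex.sin_neg]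
  ring

/-- **The dilated sinc kernel as two exponentials**: for `M > 0`, `v ≠ 0`,
`M κ(Mv) = sin(2πMv)/(πv) = Σ_{σ = ±1} (−σ i/(2π)) e^{2πiσMv} / v`. [cite: ConnesConsani2021, §4 p. 16 eq. (prolateeq); Connes1999, §VII eq. (13) (arXiv p0013)] -/
theorem dilatedSinc_eq_cexp_add {M v : ℝ} (hM : 0 < M) (hv : v ≠ 0) :
    (M : ℂ) * sincKernel (M * v) =
      -((1 : ℝ) : ℂ) * I / (2 * π) * cexp (2 * π * I * (((1 : ℝ) * M * v : ℝ) : ℂ)) * (v : ℂ)⁻¹ +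
      -((-1 : ℝ) : ℂ) * I / (2 * π) * cexp (2 * π * I * (((-1 : ℝ) * M * v : ℝ) : ℂ)) * (v : ℂ)⁻¹ := by
  have hθ : cexp (2 * π * I * (((1 : ℝ) * M * v : ℝ) : ℂ)) - cexp (2 * π * I * (((-1 : ℝ) * M * v : ℝ) : ℂ)) =
      2 * Complex.sin (2 * π * ((M * v : ℝ) : ℂ)) * I := by
    rw [← cexp_mul_I_sub_cexp_neg_mul_I]
    congr 1
    · congr 1; push_cast; ring
    · congr 1; push_cast; ring
  rw [sincKernel_eq_specialFunctionsSincKernel,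
    Literature.Analysis.SpecialFunctions.sincKernel_eq (mul_ne_zero hM.ne' hv)]
  have hv' : (v : ℂ) ≠ 0 := by exact_mod_cast hv
  have hM' : (M : ℂ) ≠ 0 := by exact_mod_cast hM.ne'
  have hπ : (π : ℂ) ≠ 0 := by exact_mod_cast Real.pi_ne_zero
  have hI : I * I = -1 := Complex.I_mul_I
  calc (M : ℂ) * (((Real.sin (2 * π * (M * v)) / (π * (M * v)) : ℝ) : ℂ))
      = Complex.sin (2 * π * ((M * v : ℝ) : ℂ)) / (π * v) := by
        push_cast
        field_simp
    _ = -(I * I) * (Complex.sin (2 * π * ((M * v : ℝ) : ℂ)) / (π * v)) := by rw [hI]; ring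
    _ = -(I / (2 * π) * (v : ℂ)⁻¹) * (2 * Complex.sin (2 * π * ((M * v : ℝ) : ℂ)) * I) := by ring
    _ = -(I / (2 * π) * (v : ℂ)⁻¹) * (cexp (2 * π * I * (((1 : ℝ) * M * v : ℝ) : ℂ)) -
          cexp (2 * π * I * (((-1 : ℝ) * M * v : ℝ) : ℂ))) := by rw [hθ]
    _ = _ := by
        simp only [Complex.ofReal_neg, Complex.ofReal_one]
        ring

/-- Two modulations combine: `e^{2πiσMx} conj(e^{2πiσMy}) = e^{2πiσM(x−y)}`. [cite: Connes1999, §VII proof of Thm 4 eqs. (29)–(33) (arXiv p0013)] -/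
theorem cexp_mul_conj_cexp (σ M x y : ℝ) :
    cexp (2 * π * I * ((σ * M * x : ℝ) : ℂ)) * conj (cexp (2 * π * I * ((σ * M * y : ℝ) : ℂ))) =
      cexp (2 * π * I * ((σ * M * (x - y) : ℝ) : ℂ)) := by
  rw [conj_cexp_two_pi_I_mul, ← Complex.exp_add]
  congr 1
  push_cast
  ring

variable (p : ℕ) [hp : Fact p.Prime]

omit hp in
/-- **The outer rank-one term**: for `|x| > e^δ`, `y ∈ Q₀`,
`u(x) conj w(y) = e^{2πiσM(x−y)} y^n/x^{n+1}` with `u(x) = e^{2πiσMx}(s/x)^n/x`, `w(y) = e^{2πiσMy}(y/s)^n`, `s = e^{δ/2}`. [cite: Connes1999, §VII proof of Thm 4 eqs. (29)–(33) (arXiv p0013)] -/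
theorem outerTerm_eq {δ M σ x y : ℝ} (n : ℕ) (hx : x ∈ {x : ℝ | Real.exp δ < |x|})
    (hy : y ∈ shellSet (p : ℝ)⁻¹ 1) :
    (cexp (2 * π * I * ((σ * M * x : ℝ) : ℂ)) *
        (({x : ℝ | Real.exp δ < |x|}.indicator (fun x => (Real.exp (δ / 2) / x) ^ n / x) x : ℝ) : ℂ)) *
      conj (cexp (2 * π * I * ((σ * M * y : ℝ) : ℂ)) *
        (((shellSet (p : ℝ)⁻¹ 1).indicator (fun y => (y / Real.exp (δ / 2)) ^ n) y : ℝ) : ℂ)) =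
      cexp (2 * π * I * ((σ * M * (x - y) : ℝ) : ℂ)) * ((y ^ n / x ^ (n + 1) : ℝ) : ℂ) := by
  have hx0 : x ≠ 0 := by
    intro h; rw [h, Set.mem_setOf_eq, abs_zero] at hx; exact (not_lt.mpr (Real.exp_pos δ).le) hx
  have hs : Real.exp (δ / 2) ≠ 0 := (Real.exp_pos _).ne'
  rw [Set.indicator_of_mem hx, Set.indicator_of_mem hy, map_mul, Complex.conj_ofReal]
  calc cexp (2 * π * I * ((σ * M * x : ℝ) : ℂ)) * (((Real.exp (δ / 2) / x) ^ n / x : ℝ) : ℂ) *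
        (conj (cexp (2 * π * I * ((σ * M * y : ℝ) : ℂ))) * (((y / Real.exp (δ / 2)) ^ n : ℝ) : ℂ))
      = (cexp (2 * π * I * ((σ * M * x : ℝ) : ℂ)) * conj (cexp (2 * π * I * ((σ * M * y : ℝ) : ℂ)))) *
          ((((Real.exp (δ / 2) / x) ^ n / x * (y / Real.exp (δ / 2)) ^ n : ℝ) : ℂ)) := by push_cast; ring
    _ = _ := by
        rw [cexp_mul_conj_cexp]
        congr 1
        congr 1
        rw [div_pow, div_pow, pow_succ]
        field_simp

/-- **The inner rank-one term**: for `|x| ≤ e^{−δ}/p`, `y ∈ Q₀`,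
`u(x) conj w(y) = e^{2πiσM(x−y)} x^n/y^{n+1}` with `u(x) = e^{2πiσMx}(psx)^n`, `w(y) = e^{2πiσMy}((psy)^n y)^{−1}`. [cite: Connes1999, §VII proof of Thm 4 eqs. (29)–(33) (arXiv p0013)] -/
theorem innerTerm_eq {δ M σ x y : ℝ} (n : ℕ) (hx : x ∈ {x : ℝ | |x| ≤ (p : ℝ)⁻¹ * Real.exp (-δ)})
    (hy : y ∈ shellSet (p : ℝ)⁻¹ 1) :
    (cexp (2 * π * I * ((σ * M * x : ℝ) : ℂ)) *
        (({x : ℝ | |x| ≤ (p : ℝ)⁻¹ * Real.exp (-δ)}.indicator (fun x => ((p : ℝ) * Real.exp (δ / 2) * x) ^ n) x : ℝ) : ℂ)) *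
      conj (cexp (2 * π * I * ((σ * M * y : ℝ) : ℂ)) *
        (((shellSet (p : ℝ)⁻¹ 1).indicator (fun y => (((p : ℝ) * Real.exp (δ / 2) * y) ^ n * y)⁻¹) y : ℝ) : ℂ)) =
      cexp (2 * π * I * ((σ * M * (x - y) : ℝ) : ℂ)) * ((x ^ n / y ^ (n + 1) : ℝ) : ℂ) := by
  have hp0 : (0 : ℝ) < p := by exact_mod_cast hp.out.pos
  have hy0 : y ≠ 0 := by
    intro h; rw [h, mem_shellSet_iff, abs_zero] at hy; exact (not_lt.mpr (inv_pos.mpr hp0).le) hy.1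
  have hs : Real.exp (δ / 2) ≠ 0 := (Real.exp_pos _).ne'
  have hps : (p : ℝ) * Real.exp (δ / 2) ≠ 0 := mul_ne_zero hp0.ne' hs
  rw [Set.indicator_of_mem hx, Set.indicator_of_mem hy, map_mul, Complex.conj_ofReal]
  calc cexp (2 * π * I * ((σ * M * x : ℝ) : ℂ)) * ((((p : ℝ) * Real.exp (δ / 2) * x) ^ n : ℝ) : ℂ) *
        (conj (cexp (2 * π * I * ((σ * M * y : ℝ) : ℂ))) * (((((p : ℝ) * Real.exp (δ / 2) * y) ^ n * y)⁻¹ : ℝ) : ℂ))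
      = (cexp (2 * π * I * ((σ * M * x : ℝ) : ℂ)) * conj (cexp (2 * π * I * ((σ * M * y : ℝ) : ℂ)))) *
          (((((p : ℝ) * Real.exp (δ / 2) * x) ^ n * (((p : ℝ) * Real.exp (δ / 2) * y) ^ n * y)⁻¹ : ℝ) : ℂ)) := by
        push_cast; ring
    _ = _ := by
        rw [cexp_mul_conj_cexp]
        congr 1
        congr 1
        rw [mul_pow, mul_pow, mul_pow, mul_pow, pow_succ]
        field_simp

/-! ## §2. The four base families are square integrable with geometric norm bounds -/

omit hp in
/-- A real indicator function dominated in square by an integrable majorant is in `L²` (as a complex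
function). [cite: ReedSimon1972, Thm. VI.23 (proof), PDF p. 199] -/
theorem memLp_ofReal_indicator {S : Set ℝ} (hS : MeasurableSet S) {g F : ℝ → ℝ} (hg : Measurable g)
    (hF : IntegrableOn F S volume) (hle : ∀ x ∈ S, g x ^ 2 ≤ F x) :
    MemLp (fun x => ((S.indicator g x : ℝ) : ℂ)) 2 (volume : Measure ℝ) := by
  have hmeas : AEStronglyMeasurable (fun x => ((S.indicator g x : ℝ) : ℂ)) (volume : Measure ℝ) :=
    (Complex.measurable_ofReal.comp (hg.indicator hS)).aestronglyMeasurable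
  rw [memLp_two_iff_integrable_sq_norm hmeas]
  refine Integrable.mono' (hF.integrable_indicator hS) (hmeas.norm.pow 2) (ae_of_all _ fun x => ?_)
  rw [Real.norm_eq_abs, abs_of_nonneg (sq_nonneg _), Complex.norm_real, Real.norm_eq_abs, sq_abs]
  by_cases hx : x ∈ S
  · rw [Set.indicator_of_mem hx, Set.indicator_of_mem hx]; exact hle x hx
  · rw [Set.indicator_of_notMem hx, Set.indicator_of_notMem hx]; simp

omit hp in
/-- … and its `L²` norm is bounded by the integral of the majorant. [cite: ReedSimon1972, Thm. VI.23 (proof), PDF p. 199] -/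
theorem norm_toLp_ofReal_indicator_sq_le {S : Set ℝ} (hS : MeasurableSet S) {g F : ℝ → ℝ}
    (hF : IntegrableOn F S volume) (hle : ∀ x ∈ S, g x ^ 2 ≤ F x)
    (h : MemLp (fun x => ((S.indicator g x : ℝ) : ℂ)) 2 (volume : Measure ℝ)) :
    ‖h.toLp _‖ ^ 2 ≤ ∫ x in S, F x := by
  rw [norm_toLp_sq_eq_integral_norm_sq h, ← integral_indicator hS]
  refine integral_mono_of_nonneg (ae_of_all _ fun x => sq_nonneg _) (hF.integrable_indicator hS)
    (ae_of_all _ fun x => ?_)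
  change ‖((S.indicator g x : ℝ) : ℂ)‖ ^ 2 ≤ S.indicator F x
  rw [Complex.norm_real, Real.norm_eq_abs, sq_abs]
  by_cases hx : x ∈ S
  · rw [Set.indicator_of_mem hx, Set.indicator_of_mem hx]; exact hle x hx
  · rw [Set.indicator_of_notMem hx, Set.indicator_of_notMem hx]; simp

omit hp in
/-- `e^{δ/2} · e^{δ/2} = e^{δ}`. [cite: Connes1999, §VII proof of Thm 4 (arXiv p0013)] -/
theorem exp_half_sq (δ : ℝ) : Real.exp (δ / 2) ^ 2 = Real.exp δ := by
  rw [sq, ← Real.exp_add]; ring_nf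

omit hp in
/-- **Outer `u`-family**: `x ↦ 1_{|x|>e^δ} (s/x)^n/x` is in `L²` with `‖·‖² ≤ e^{−δn} ∫_{|x|>e^δ} x^{−2}`. [cite: Connes1999, §VII proof of Thm 4 eqs. (29)–(33) (arXiv p0013)] -/
theorem outerU_sq_le (δ : ℝ) (n : ℕ) (x : ℝ) (hx : x ∈ {x : ℝ | Real.exp δ < |x|}) :
    ((Real.exp (δ / 2) / x) ^ n / x) ^ 2 ≤ Real.exp (-δ) ^ n * (|x| ^ 2)⁻¹ := by
  have hx' : Real.exp δ < |x| := hx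
  have hx0 : 0 < |x| := (Real.exp_pos δ).trans hx'
  have hx2 : Real.exp δ ^ 2 ≤ x ^ 2 := by
    rw [← sq_abs x]; exact pow_le_pow_left₀ (Real.exp_pos δ).le hx'.le 2
  have hratio : (Real.exp (δ / 2) / x) ^ 2 ≤ Real.exp (-δ) := by
    have hx2pos : (0 : ℝ) < x ^ 2 := by rw [← sq_abs]; exact pow_pos hx0 2
    rw [div_pow, exp_half_sq, div_le_iff₀ hx2pos]
    calc Real.exp δ = Real.exp (-δ) * Real.exp δ ^ 2 := by
          rw [sq, ← Real.exp_add, ← Real.exp_add]; ring_nf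
      _ ≤ Real.exp (-δ) * x ^ 2 := mul_le_mul_of_nonneg_left hx2 (Real.exp_pos _).le
  rw [div_pow, ← pow_mul, mul_comm n 2, pow_mul, sq_abs]
  rw [div_eq_mul_inv]
  exact mul_le_mul_of_nonneg_right (pow_le_pow_left₀ (sq_nonneg _) hratio n) (inv_nonneg.mpr (sq_nonneg _))

omit hp in
/-- **Outer `w`-family**: on `Q₀`, `((y/s)^n)² ≤ e^{−δ n}`. [cite: Connes1999, §VII proof of Thm 4 eqs. (29)–(33) (arXiv p0013)] -/
theorem outerW_sq_le (δ : ℝ) (n : ℕ) (y : ℝ) (hy : y ∈ shellSet (p : ℝ)⁻¹ 1) :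
    ((y / Real.exp (δ / 2)) ^ n) ^ 2 ≤ Real.exp (-δ) ^ n := by
  have hy1 : |y| ≤ 1 := (mem_shellSet_iff.mp hy).2
  have hratio : (y / Real.exp (δ / 2)) ^ 2 ≤ Real.exp (-δ) := by
    rw [div_pow, exp_half_sq, div_le_iff₀ (Real.exp_pos δ), ← sq_abs]
    calc |y| ^ 2 ≤ 1 := pow_le_one₀ (abs_nonneg _) hy1
      _ = Real.exp (-δ) * Real.exp δ := by rw [← Real.exp_add, neg_add_cancel, Real.exp_zero]
  rw [← pow_mul, mul_comm n 2, pow_mul]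
  exact pow_le_pow_left₀ (sq_nonneg _) hratio n

/-- **Inner `u`-family**: on `|x| ≤ e^{−δ}/p`, `((psx)^n)² ≤ e^{−δ n}`. [cite: Connes1999, §VII proof of Thm 4 eqs. (29)–(33) (arXiv p0013)] -/
theorem innerU_sq_le (δ : ℝ) (n : ℕ) (x : ℝ) (hx : x ∈ {x : ℝ | |x| ≤ (p : ℝ)⁻¹ * Real.exp (-δ)}) :
    (((p : ℝ) * Real.exp (δ / 2) * x) ^ n) ^ 2 ≤ Real.exp (-δ) ^ n := by
  have hp0 : (0 : ℝ) < p := by exact_mod_cast hp.out.pos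
  have hx' : |x| ≤ (p : ℝ)⁻¹ * Real.exp (-δ) := hx
  have hratio : ((p : ℝ) * Real.exp (δ / 2) * x) ^ 2 ≤ Real.exp (-δ) := by
    rw [← sq_abs, abs_mul, abs_mul, abs_of_pos hp0, abs_of_pos (Real.exp_pos _)]
    have h1 : (p : ℝ) * Real.exp (δ / 2) * |x| ≤ Real.exp (δ / 2) * Real.exp (-δ) := by
      calc (p : ℝ) * Real.exp (δ / 2) * |x| ≤ (p : ℝ) * Real.exp (δ / 2) * ((p : ℝ)⁻¹ * Real.exp (-δ)) :=
            mul_le_mul_of_nonneg_left hx' (by positivity)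
        _ = Real.exp (δ / 2) * Real.exp (-δ) := by field_simp
    have h2 : (Real.exp (δ / 2) * Real.exp (-δ)) ^ 2 = Real.exp (-δ) := by
      rw [sq, ← Real.exp_add, ← Real.exp_add]; congr 1; ring
    calc ((p : ℝ) * Real.exp (δ / 2) * |x|) ^ 2 ≤ (Real.exp (δ / 2) * Real.exp (-δ)) ^ 2 :=
          pow_le_pow_left₀ (by positivity) h1 2
      _ = Real.exp (-δ) := h2
  rw [← pow_mul, mul_comm n 2, pow_mul]
  exact pow_le_pow_left₀ (sq_nonneg _) hratio n

/-- **Inner `w`-family**: on `Q₀`, `(((psy)^n y)^{−1})² ≤ p² e^{−δ n}`. [cite: Connes1999, §VII proof of Thm 4 eqs. (29)–(33) (arXiv p0013)] -/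
theorem innerW_sq_le (δ : ℝ) (n : ℕ) (y : ℝ) (hy : y ∈ shellSet (p : ℝ)⁻¹ 1) :
    ((((p : ℝ) * Real.exp (δ / 2) * y) ^ n * y)⁻¹) ^ 2 ≤ (p : ℝ) ^ 2 * Real.exp (-δ) ^ n := by
  have hp0 : (0 : ℝ) < p := by exact_mod_cast hp.out.pos
  have hy1 : (p : ℝ)⁻¹ < |y| := (mem_shellSet_iff.mp hy).1
  have hy0 : 0 < |y| := (inv_pos.mpr hp0).trans hy1
  -- `(psy)² > e^{δ}` so `((psy)²)⁻¹ ≤ e^{−δ}`; `y⁻² < p²`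
  have ha : Real.exp δ ≤ ((p : ℝ) * Real.exp (δ / 2) * y) ^ 2 := by
    rw [← sq_abs, abs_mul, abs_mul, abs_of_pos hp0, abs_of_pos (Real.exp_pos _), ← exp_half_sq]
    refine pow_le_pow_left₀ (Real.exp_pos _).le ?_ 2
    calc Real.exp (δ / 2) = (p : ℝ) * Real.exp (δ / 2) * (p : ℝ)⁻¹ := by field_simp
      _ ≤ (p : ℝ) * Real.exp (δ / 2) * |y| := mul_le_mul_of_nonneg_left hy1.le (by positivity)
  have ha0 : 0 < ((p : ℝ) * Real.exp (δ / 2) * y) ^ 2 := (Real.exp_pos δ).trans_le ha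
  have hinv1 : (((p : ℝ) * Real.exp (δ / 2) * y) ^ 2)⁻¹ ≤ Real.exp (-δ) := by
    rw [Real.exp_neg]; exact inv_anti₀ (Real.exp_pos δ) ha
  have hinv2 : (y ^ 2)⁻¹ ≤ (p : ℝ) ^ 2 := by
    rw [← sq_abs, ← inv_pow]
    refine pow_le_pow_left₀ (inv_nonneg.mpr (abs_nonneg _)) ?_ 2
    rw [inv_le_comm₀ hy0 hp0]; exact hy1.le
  calc ((((p : ℝ) * Real.exp (δ / 2) * y) ^ n * y)⁻¹) ^ 2
      = ((((p : ℝ) * Real.exp (δ / 2) * y) ^ 2)⁻¹) ^ n * (y ^ 2)⁻¹ := by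
        rw [inv_pow, mul_pow, ← pow_mul, mul_comm n 2, pow_mul, mul_inv, inv_pow]
    _ ≤ Real.exp (-δ) ^ n * (p : ℝ) ^ 2 :=
        mul_le_mul (pow_le_pow_left₀ (inv_nonneg.mpr ha0.le) hinv1 n) hinv2 (inv_nonneg.mpr (sq_nonneg _))
          (pow_nonneg (Real.exp_pos _).le n)
    _ = (p : ℝ) ^ 2 * Real.exp (-δ) ^ n := mul_comm _ _

omit hp in
/-- The inner region `{|x| ≤ c}` is the interval `[−c, c]`. [cite: Connes1999, §VII eq. (12) (arXiv p0013)] -/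
theorem setOf_abs_le_eq_Icc (c : ℝ) : {x : ℝ | |x| ≤ c} = Set.Icc (-c) c := by
  ext x; simp only [Set.mem_setOf_eq, Set.mem_Icc, abs_le]

/-- **The four base families are in `L²(ℝ)`.** [cite: Connes1999, §VII proof of Thm 4 eqs. (29)–(33) (arXiv p0013); ReedSimon1972, Thm. VI.23, PDF p. 199] -/
theorem memLp_baseFamilies (δ : ℝ) (n : ℕ) :
    MemLp (fun x => (({x : ℝ | Real.exp δ < |x|}.indicator (fun x => (Real.exp (δ / 2) / x) ^ n / x) x : ℝ) : ℂ))
        2 (volume : Measure ℝ) ∧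
    MemLp (fun y => (((shellSet (p : ℝ)⁻¹ 1).indicator (fun y => (y / Real.exp (δ / 2)) ^ n) y : ℝ) : ℂ))
        2 (volume : Measure ℝ) ∧
    MemLp (fun x => (({x : ℝ | |x| ≤ (p : ℝ)⁻¹ * Real.exp (-δ)}.indicator
        (fun x => ((p : ℝ) * Real.exp (δ / 2) * x) ^ n) x : ℝ) : ℂ)) 2 (volume : Measure ℝ) ∧
    MemLp (fun y => (((shellSet (p : ℝ)⁻¹ 1).indicator
        (fun y => (((p : ℝ) * Real.exp (δ / 2) * y) ^ n * y)⁻¹) y : ℝ) : ℂ)) 2 (volume : Measure ℝ) := by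
  refine ⟨?_, ?_, ?_, ?_⟩
  · exact memLp_ofReal_indicator (measurableSet_lt measurable_const continuous_abs.measurable) (by fun_prop)
      ((integrableOn_inv_abs_sq (Real.exp_pos δ)).const_mul _) (fun x hx => outerU_sq_le δ n x hx)
  · exact memLp_ofReal_indicator (measurableSet_shellSet _ _) (by fun_prop)
      (integrableOn_const (volume_shellSet_lt_top _ _).ne) (fun y hy => outerW_sq_le p δ n y hy)
  · refine memLp_ofReal_indicator ?_ (by fun_prop) (integrableOn_const ?_) (fun x hx => innerU_sq_le p δ n x hx)
    · rw [setOf_abs_le_eq_Icc]; exact measurableSet_Icc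
    · rw [setOf_abs_le_eq_Icc, Real.volume_Icc]; exact ENNReal.ofReal_ne_top
  · exact memLp_ofReal_indicator (measurableSet_shellSet _ _) (by fun_prop)
      (integrableOn_const (volume_shellSet_lt_top _ _).ne) (fun y hy => innerW_sq_le p δ n y hy)

/-- **The geometric norm bounds**: with `C₁ = ∫_{|x|>e^δ} x^{−2} dx`, the four base families satisfy
`‖u_out‖² ≤ e^{−δn} C₁`, `‖w_out‖² ≤ 2e^{−δn}`, `‖u_in‖² ≤ 2e^{−δn}`, `‖w_in‖² ≤ 2p² e^{−δn}` (any `L²` witnesses). [cite: Connes1999, §VII proof of Thm 4 eqs. (29)–(33) (arXiv p0013)] -/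
theorem norm_sq_baseFamilies_le {δ : ℝ} (hδ : 0 < δ) (n : ℕ)
    (h₁ : MemLp (fun x => (({x : ℝ | Real.exp δ < |x|}.indicator (fun x => (Real.exp (δ / 2) / x) ^ n / x) x : ℝ) : ℂ))
        2 (volume : Measure ℝ))
    (h₂ : MemLp (fun y => (((shellSet (p : ℝ)⁻¹ 1).indicator (fun y => (y / Real.exp (δ / 2)) ^ n) y : ℝ) : ℂ))
        2 (volume : Measure ℝ))
    (h₃ : MemLp (fun x => (({x : ℝ | |x| ≤ (p : ℝ)⁻¹ * Real.exp (-δ)}.indicator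
        (fun x => ((p : ℝ) * Real.exp (δ / 2) * x) ^ n) x : ℝ) : ℂ)) 2 (volume : Measure ℝ))
    (h₄ : MemLp (fun y => (((shellSet (p : ℝ)⁻¹ 1).indicator
        (fun y => (((p : ℝ) * Real.exp (δ / 2) * y) ^ n * y)⁻¹) y : ℝ) : ℂ)) 2 (volume : Measure ℝ)) :
    ‖h₁.toLp _‖ ^ 2 ≤ Real.exp (-δ) ^ n * ∫ x in {x : ℝ | Real.exp δ < |x|}, (|x| ^ 2)⁻¹ ∧
    ‖h₂.toLp _‖ ^ 2 ≤ 2 * Real.exp (-δ) ^ n ∧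
    ‖h₃.toLp _‖ ^ 2 ≤ 2 * Real.exp (-δ) ^ n ∧
    ‖h₄.toLp _‖ ^ 2 ≤ 2 * (p : ℝ) ^ 2 * Real.exp (-δ) ^ n := by
  have hp0 : (0 : ℝ) < p := by exact_mod_cast hp.out.pos
  have hp1 : (1 : ℝ) ≤ p := by exact_mod_cast hp.out.one_lt.le
  have hr0 : 0 ≤ Real.exp (-δ) ^ n := pow_nonneg (Real.exp_pos _).le n
  have hQ := volume_real_shellSet_le p
  refine ⟨?_, ?_, ?_, ?_⟩
  · have h := norm_toLp_ofReal_indicator_sq_le (measurableSet_lt measurable_const continuous_abs.measurable)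
      ((integrableOn_inv_abs_sq (Real.exp_pos δ)).const_mul (Real.exp (-δ) ^ n)) (fun x hx => outerU_sq_le δ n x hx) h₁
    rwa [integral_const_mul] at h
  · have h := norm_toLp_ofReal_indicator_sq_le (measurableSet_shellSet _ _)
      (integrableOn_const (volume_shellSet_lt_top _ _).ne) (fun y hy => outerW_sq_le p δ n y hy) h₂
    rw [setIntegral_const, smul_eq_mul] at h
    refine h.trans ?_
    nlinarith
  · have hmeas : MeasurableSet {x : ℝ | |x| ≤ (p : ℝ)⁻¹ * Real.exp (-δ)} := by
      rw [setOf_abs_le_eq_Icc]; exact measurableSet_Icc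
    have hvol : volume {x : ℝ | |x| ≤ (p : ℝ)⁻¹ * Real.exp (-δ)} ≠ ⊤ := by
      rw [setOf_abs_le_eq_Icc, Real.volume_Icc]; exact ENNReal.ofReal_ne_top
    have h := norm_toLp_ofReal_indicator_sq_le hmeas (integrableOn_const hvol) (fun x hx => innerU_sq_le p δ n x hx) h₃
    rw [setIntegral_const, smul_eq_mul] at h
    refine h.trans ?_
    have hc : (volume : Measure ℝ).real {x : ℝ | |x| ≤ (p : ℝ)⁻¹ * Real.exp (-δ)} ≤ 2 := by
      rw [setOf_abs_le_eq_Icc, Real.volume_real_Icc_of_le (by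
        have : 0 < (p : ℝ)⁻¹ * Real.exp (-δ) := by positivity
        linarith)]
      have h1 : (p : ℝ)⁻¹ ≤ 1 := inv_le_one_of_one_le₀ hp1
      have h2 : Real.exp (-δ) ≤ 1 := Real.exp_le_one_iff.mpr (by linarith)
      have h3 : (p : ℝ)⁻¹ * Real.exp (-δ) ≤ 1 := by
        calc (p : ℝ)⁻¹ * Real.exp (-δ) ≤ 1 * 1 :=
              mul_le_mul h1 h2 (Real.exp_pos _).le zero_le_one
          _ = 1 := mul_one _
      linarith
    nlinarith [measureReal_nonneg (μ := (volume : Measure ℝ)) (s := {x : ℝ | |x| ≤ (p : ℝ)⁻¹ * Real.exp (-δ)})]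
  · have h := norm_toLp_ofReal_indicator_sq_le (measurableSet_shellSet _ _)
      (integrableOn_const (volume_shellSet_lt_top _ _).ne) (fun y hy => innerW_sq_le p δ n y hy) h₄
    rw [setIntegral_const, smul_eq_mul] at h
    refine h.trans ?_
    have : 0 ≤ (p : ℝ) ^ 2 * Real.exp (-δ) ^ n := by positivity
    nlinarith [measureReal_nonneg (μ := (volume : Measure ℝ)) (s := shellSet (p : ℝ)⁻¹ 1)]

/-! ## §3. The pointwise expansion of the separated kernel -/

omit hp in
/-- `e^δ > 1` for `δ > 0`. [cite: Connes1999, §VII proof of Thm 4 (arXiv p0013)] -/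
theorem one_lt_exp_of_pos {δ : ℝ} (hδ : 0 < δ) : 1 < Real.exp δ := by
  have := Real.add_one_le_exp δ; linarith

omit hp in
/-- **Outer geometric series**: for `|x| > e^δ`, `y ∈ Q₀`,
`Σ_n u_n(x) conj w_n(y) = e^{2πiσM(x−y)} (x − y)^{−1}`. [cite: Connes1999, §VII proof of Thm 4 eqs. (29)–(33) (arXiv p0013)] -/
theorem hasSum_outerTerms {δ : ℝ} (hδ : 0 < δ) (M σ : ℝ) {x y : ℝ} (hx : x ∈ {x : ℝ | Real.exp δ < |x|})
    (hy : y ∈ shellSet (p : ℝ)⁻¹ 1) :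
    HasSum (fun n : ℕ => (cexp (2 * π * I * ((σ * M * x : ℝ) : ℂ)) *
        (({x : ℝ | Real.exp δ < |x|}.indicator (fun x => (Real.exp (δ / 2) / x) ^ n / x) x : ℝ) : ℂ)) *
      conj (cexp (2 * π * I * ((σ * M * y : ℝ) : ℂ)) *
        (((shellSet (p : ℝ)⁻¹ 1).indicator (fun y => (y / Real.exp (δ / 2)) ^ n) y : ℝ) : ℂ)))
      (cexp (2 * π * I * ((σ * M * (x - y) : ℝ) : ℂ)) * (((x - y)⁻¹ : ℝ) : ℂ)) := by
  have hyx : |y| < |x| := by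
    have h1 : |y| ≤ 1 := (mem_shellSet_iff.mp hy).2
    have h2 : Real.exp δ < |x| := hx
    linarith [one_lt_exp_of_pos hδ]
  have h := (Complex.hasSum_ofReal.mpr (hasSum_inv_sub_outer hyx)).mul_left
    (cexp (2 * π * I * ((σ * M * (x - y) : ℝ) : ℂ)))
  refine h.congr_fun fun n => ?_
  exact outerTerm_eq p n hx hy

/-- **Inner geometric series**: for `|x| ≤ e^{−δ}/p`, `y ∈ Q₀`,
`Σ_n u_n(x) conj w_n(y) = −e^{2πiσM(x−y)} (x − y)^{−1}`. [cite: Connes1999, §VII proof of Thm 4 eqs. (29)–(33) (arXiv p0013)] -/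
theorem hasSum_innerTerms {δ : ℝ} (hδ : 0 < δ) (M σ : ℝ) {x y : ℝ}
    (hx : x ∈ {x : ℝ | |x| ≤ (p : ℝ)⁻¹ * Real.exp (-δ)}) (hy : y ∈ shellSet (p : ℝ)⁻¹ 1) :
    HasSum (fun n : ℕ => (cexp (2 * π * I * ((σ * M * x : ℝ) : ℂ)) *
        (({x : ℝ | |x| ≤ (p : ℝ)⁻¹ * Real.exp (-δ)}.indicator (fun x => ((p : ℝ) * Real.exp (δ / 2) * x) ^ n) x : ℝ) : ℂ)) *
      conj (cexp (2 * π * I * ((σ * M * y : ℝ) : ℂ)) *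
        (((shellSet (p : ℝ)⁻¹ 1).indicator (fun y => (((p : ℝ) * Real.exp (δ / 2) * y) ^ n * y)⁻¹) y : ℝ) : ℂ)))
      (cexp (2 * π * I * ((σ * M * (x - y) : ℝ) : ℂ)) * ((-(x - y)⁻¹ : ℝ) : ℂ)) := by
  have hp0 : (0 : ℝ) < p := by exact_mod_cast hp.out.pos
  have hxy : |x| < |y| := by
    have h1 : (p : ℝ)⁻¹ < |y| := (mem_shellSet_iff.mp hy).1
    have h2 : |x| ≤ (p : ℝ)⁻¹ * Real.exp (-δ) := hx
    have h3 : Real.exp (-δ) < 1 := Real.exp_lt_one_iff.mpr (by linarith)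
    have h4 : (p : ℝ)⁻¹ * Real.exp (-δ) < (p : ℝ)⁻¹ := mul_lt_of_lt_one_right (inv_pos.mpr hp0) h3
    linarith
  have h0 := (hasSum_inv_sub_inner hxy).neg
  simp only [neg_neg] at h0
  have h := (Complex.hasSum_ofReal.mpr h0).mul_left (cexp (2 * π * I * ((σ * M * (x - y) : ℝ) : ℂ)))
  refine h.congr_fun fun n => ?_
  exact innerTerm_eq p n hx hy

/-- If `x ∉ Q̃` and `y ∈ Q₀` then `x ≠ y` (`Q₀ ⊆ Q̃`). [cite: Connes1999, §VII eq. (12) (arXiv p0013)] -/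
theorem sub_ne_zero_of_separated {δ x y : ℝ} (hδ : 0 < δ)
    (hx : x ∉ shellSet ((p : ℝ)⁻¹ * Real.exp (-δ)) (Real.exp δ)) (hy : y ∈ shellSet (p : ℝ)⁻¹ 1) :
    x - y ≠ 0 := by
  intro h
  have hxy : x = y := sub_eq_zero.mp h
  have hp0 : (0 : ℝ) < p := by exact_mod_cast hp.out.pos
  have he : Real.exp (-δ) < 1 := Real.exp_lt_one_iff.mpr (by linarith)
  rw [hxy, mem_shellSet_iff] at hx
  rw [mem_shellSet_iff] at hy
  apply hx
  constructor
  · calc (p : ℝ)⁻¹ * Real.exp (-δ) < (p : ℝ)⁻¹ * 1 := mul_lt_mul_of_pos_left he (inv_pos.mpr hp0)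
      _ = (p : ℝ)⁻¹ := mul_one _
      _ < |y| := hy.1
  · exact hy.2.trans (one_lt_exp_of_pos hδ).le

omit hp in
/-- All outer terms vanish when `x` is off the outer region or `y ∉ Q₀`. [cite: Connes1999, §VII proof of Thm 4 eqs. (29)–(33) (arXiv p0013)] -/
theorem hasSum_outerTerms_zero (δ M σ : ℝ) {x y : ℝ}
    (h : x ∉ {x : ℝ | Real.exp δ < |x|} ∨ y ∉ shellSet (p : ℝ)⁻¹ 1) :
    HasSum (fun n : ℕ => (cexp (2 * π * I * ((σ * M * x : ℝ) : ℂ)) *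
        (({x : ℝ | Real.exp δ < |x|}.indicator (fun x => (Real.exp (δ / 2) / x) ^ n / x) x : ℝ) : ℂ)) *
      conj (cexp (2 * π * I * ((σ * M * y : ℝ) : ℂ)) *
        (((shellSet (p : ℝ)⁻¹ 1).indicator (fun y => (y / Real.exp (δ / 2)) ^ n) y : ℝ) : ℂ))) 0 := by
  rcases h with h | h
  · simp only [Set.indicator_of_notMem h, Complex.ofReal_zero, mul_zero, zero_mul]
    exact hasSum_zero
  · simp only [Set.indicator_of_notMem h, Complex.ofReal_zero, mul_zero, map_zero]
    exact hasSum_zero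

omit hp in
/-- All inner terms vanish when `x` is off the inner region or `y ∉ Q₀`. [cite: Connes1999, §VII proof of Thm 4 eqs. (29)–(33) (arXiv p0013)] -/
theorem hasSum_innerTerms_zero (δ M σ : ℝ) {x y : ℝ}
    (h : x ∉ {x : ℝ | |x| ≤ (p : ℝ)⁻¹ * Real.exp (-δ)} ∨ y ∉ shellSet (p : ℝ)⁻¹ 1) :
    HasSum (fun n : ℕ => (cexp (2 * π * I * ((σ * M * x : ℝ) : ℂ)) *
        (({x : ℝ | |x| ≤ (p : ℝ)⁻¹ * Real.exp (-δ)}.indicator (fun x => ((p : ℝ) * Real.exp (δ / 2) * x) ^ n) x : ℝ) : ℂ)) *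
      conj (cexp (2 * π * I * ((σ * M * y : ℝ) : ℂ)) *
        (((shellSet (p : ℝ)⁻¹ 1).indicator (fun y => (((p : ℝ) * Real.exp (δ / 2) * y) ^ n * y)⁻¹) y : ℝ) : ℂ))) 0 := by
  rcases h with h | h
  · simp only [Set.indicator_of_notMem h, Complex.ofReal_zero, mul_zero, zero_mul]
    exact hasSum_zero
  · simp only [Set.indicator_of_notMem h, Complex.ofReal_zero, mul_zero, map_zero]
    exact hasSum_zero

omit hp in
/-- Assembling a series over `α ⊕ β` from its two halves (values and terms identified pointwise).
[cite: ReedSimon1972, §VI.5, PDF p. 196] -/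
theorem hasSum_sum_of_pieces {α β : Type*} {G : α ⊕ β → ℂ} {g₁ : α → ℂ} {g₂ : β → ℂ} {a b V : ℂ}
    (h₁ : HasSum g₁ a) (h₂ : HasSum g₂ b) (e₁ : ∀ j, G (Sum.inl j) = g₁ j) (e₂ : ∀ j, G (Sum.inr j) = g₂ j)
    (hV : a + b = V) : HasSum G V := by
  rw [← hV]
  refine HasSum.sum ?_ ?_
  · exact (show G ∘ Sum.inl = g₁ from funext e₁) ▸ h₁
  · exact (show G ∘ Sum.inr = g₂ from funext e₂) ▸ h₂

/-- **The `σ`-piece**: for fixed sign `σ`, over `ℕ ⊕ ℕ` (outer / inner region) the terms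
`λ_j u_j(x) conj w_j(y)` (`λ = −σi/2π` outer, `+σi/2π` inner) sum to
`1_{x∉Q̃} 1_{y∈Q₀} (−σ i/2π) e^{2πiσM(x−y)} / (x − y)`. [cite: Connes1999, §VII proof of Thm 4 eqs. (29)–(33) (arXiv p0013)] -/
theorem hasSum_sigmaPiece {δ : ℝ} (hδ : 0 < δ) (M σ x y : ℝ) :
    HasSum (fun j : ℕ ⊕ ℕ =>
        Sum.elim (fun _ : ℕ => -(σ : ℂ) * I / (2 * π)) (fun _ : ℕ => (σ : ℂ) * I / (2 * π)) j *
        ((cexp (2 * π * I * ((σ * M * x : ℝ) : ℂ)) *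
            Sum.elim
              (fun (n : ℕ) (x : ℝ) => (({x : ℝ | Real.exp δ < |x|}.indicator
                (fun x => (Real.exp (δ / 2) / x) ^ n / x) x : ℝ) : ℂ))
              (fun (n : ℕ) (x : ℝ) => (({x : ℝ | |x| ≤ (p : ℝ)⁻¹ * Real.exp (-δ)}.indicator
                (fun x => ((p : ℝ) * Real.exp (δ / 2) * x) ^ n) x : ℝ) : ℂ)) j x) *
          conj (cexp (2 * π * I * ((σ * M * y : ℝ) : ℂ)) *
            Sum.elim
              (fun (n : ℕ) (y : ℝ) => (((shellSet (p : ℝ)⁻¹ 1).indicator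
                (fun y => (y / Real.exp (δ / 2)) ^ n) y : ℝ) : ℂ))
              (fun (n : ℕ) (y : ℝ) => (((shellSet (p : ℝ)⁻¹ 1).indicator
                (fun y => (((p : ℝ) * Real.exp (δ / 2) * y) ^ n * y)⁻¹) y : ℝ) : ℂ)) j y)))
      ((shellSet ((p : ℝ)⁻¹ * Real.exp (-δ)) (Real.exp δ))ᶜ.indicator (fun _ => (1 : ℂ)) x *
        (shellSet (p : ℝ)⁻¹ 1).indicator (fun _ => (1 : ℂ)) y *
        (-(σ : ℂ) * I / (2 * π) * cexp (2 * π * I * ((σ * M * (x - y) : ℝ) : ℂ)) * ((x - y : ℝ) : ℂ)⁻¹)) := by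
  have hp0 : (0 : ℝ) < p := by exact_mod_cast hp.out.pos
  have he1 : 1 < Real.exp δ := one_lt_exp_of_pos hδ
  by_cases hy : y ∈ shellSet (p : ℝ)⁻¹ 1
  swap
  · rw [Set.indicator_of_notMem hy, mul_zero, zero_mul]
    refine hasSum_sum_of_pieces ((hasSum_outerTerms_zero p δ M σ (Or.inr hy)).mul_left (-(σ : ℂ) * I / (2 * π)))
      ((hasSum_innerTerms_zero p δ M σ (Or.inr hy)).mul_left ((σ : ℂ) * I / (2 * π))) (fun j => rfl) (fun j => rfl) ?_
    simp
  rw [Set.indicator_of_mem hy, mul_one]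
  by_cases hxo : x ∈ {x : ℝ | Real.exp δ < |x|}
  · -- outer region: the inner terms vanish
    have hxo' : Real.exp δ < |x| := hxo
    have hxi : x ∉ {x : ℝ | |x| ≤ (p : ℝ)⁻¹ * Real.exp (-δ)} := by
      intro h
      have h' : |x| ≤ (p : ℝ)⁻¹ * Real.exp (-δ) := h
      have h1 : (p : ℝ)⁻¹ ≤ 1 := inv_le_one_of_one_le₀ (by exact_mod_cast hp.out.one_lt.le)
      have h2 : Real.exp (-δ) < 1 := Real.exp_lt_one_iff.mpr (by linarith)
      nlinarith [Real.exp_pos (-δ), inv_pos.mpr hp0]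
    have hxQ : x ∈ (shellSet ((p : ℝ)⁻¹ * Real.exp (-δ)) (Real.exp δ))ᶜ := by
      rw [Set.mem_compl_iff, mem_shellSet_iff, not_and_or]; exact Or.inr (not_le.mpr hxo')
    rw [Set.indicator_of_mem hxQ, one_mul]
    refine hasSum_sum_of_pieces ((hasSum_outerTerms p hδ M σ hxo hy).mul_left (-(σ : ℂ) * I / (2 * π)))
      ((hasSum_innerTerms_zero p δ M σ (Or.inl hxi)).mul_left ((σ : ℂ) * I / (2 * π))) (fun j => rfl) (fun j => rfl) ?_
    rw [Complex.ofReal_inv]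
    ring
  by_cases hxi : x ∈ {x : ℝ | |x| ≤ (p : ℝ)⁻¹ * Real.exp (-δ)}
  · -- inner region: the outer terms vanish
    have hxi' : |x| ≤ (p : ℝ)⁻¹ * Real.exp (-δ) := hxi
    have hxQ : x ∈ (shellSet ((p : ℝ)⁻¹ * Real.exp (-δ)) (Real.exp δ))ᶜ := by
      rw [Set.mem_compl_iff, mem_shellSet_iff, not_and_or]; exact Or.inl (not_lt.mpr hxi')
    rw [Set.indicator_of_mem hxQ, one_mul]
    refine hasSum_sum_of_pieces ((hasSum_outerTerms_zero p δ M σ (Or.inl hxo)).mul_left (-(σ : ℂ) * I / (2 * π)))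
      ((hasSum_innerTerms p hδ M σ hxi hy).mul_left ((σ : ℂ) * I / (2 * π))) (fun j => rfl) (fun j => rfl) ?_
    rw [Complex.ofReal_neg, Complex.ofReal_inv]
    ring
  · -- `x ∈ Q̃`: everything vanishes
    have hxQ : x ∉ (shellSet ((p : ℝ)⁻¹ * Real.exp (-δ)) (Real.exp δ))ᶜ := by
      rw [Set.mem_compl_iff, not_not, mem_shellSet_iff]
      exact ⟨not_le.mp hxi, not_lt.mp hxo⟩
    rw [Set.indicator_of_notMem hxQ, zero_mul]
    refine hasSum_sum_of_pieces ((hasSum_outerTerms_zero p δ M σ (Or.inl hxo)).mul_left (-(σ : ℂ) * I / (2 * π)))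
      ((hasSum_innerTerms_zero p δ M σ (Or.inl hxi)).mul_left ((σ : ℂ) * I / (2 * π))) (fun j => rfl) (fun j => rfl) ?_
    simp

/-- **The pointwise rank-one expansion of the separated sinc kernel** over `K = (ℕ ⊕ ℕ) ⊕ (ℕ ⊕ ℕ)`
(sign `+` / `−`; outer / inner; `n`): for `M > 0` and all `x, y`,
`Σ_k λ_k u_k^M(x) conj w_k^M(y) = 1_{x∉Q̃} · M κ(M(x−y)) · 1_{y∈Q₀}`. [cite: Connes1999, §VII eq. (13) and proof of Thm 4 eqs. (29)–(33) (arXiv p0013); ConnesConsani2021, §4 eq. (prolateeq)] -/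
theorem hasSum_separatedSinc_kernel {δ M : ℝ} (hδ : 0 < δ) (hM : 0 < M) (x y : ℝ) :
    HasSum (fun k : (ℕ ⊕ ℕ) ⊕ (ℕ ⊕ ℕ) =>
        Sum.elim
          (Sum.elim (fun _ : ℕ => -((1 : ℝ) : ℂ) * I / (2 * π)) (fun _ : ℕ => ((1 : ℝ) : ℂ) * I / (2 * π)))
          (Sum.elim (fun _ : ℕ => -((-1 : ℝ) : ℂ) * I / (2 * π)) (fun _ : ℕ => ((-1 : ℝ) : ℂ) * I / (2 * π))) k *
        ((cexp (2 * π * I * ((Sum.elim (fun _ : ℕ ⊕ ℕ => (1 : ℝ)) (fun _ : ℕ ⊕ ℕ => (-1 : ℝ)) k * M * x : ℝ) : ℂ)) *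
            Sum.elim
              (Sum.elim
                (fun (n : ℕ) (x : ℝ) => (({x : ℝ | Real.exp δ < |x|}.indicator
                  (fun x => (Real.exp (δ / 2) / x) ^ n / x) x : ℝ) : ℂ))
                (fun (n : ℕ) (x : ℝ) => (({x : ℝ | |x| ≤ (p : ℝ)⁻¹ * Real.exp (-δ)}.indicator
                  (fun x => ((p : ℝ) * Real.exp (δ / 2) * x) ^ n) x : ℝ) : ℂ)))
              (Sum.elim
                (fun (n : ℕ) (x : ℝ) => (({x : ℝ | Real.exp δ < |x|}.indicator
                  (fun x => (Real.exp (δ / 2) / x) ^ n / x) x : ℝ) : ℂ))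
                (fun (n : ℕ) (x : ℝ) => (({x : ℝ | |x| ≤ (p : ℝ)⁻¹ * Real.exp (-δ)}.indicator
                  (fun x => ((p : ℝ) * Real.exp (δ / 2) * x) ^ n) x : ℝ) : ℂ))) k x) *
          conj (cexp (2 * π * I * ((Sum.elim (fun _ : ℕ ⊕ ℕ => (1 : ℝ)) (fun _ : ℕ ⊕ ℕ => (-1 : ℝ)) k * M * y : ℝ) : ℂ)) *
            Sum.elim
              (Sum.elim
                (fun (n : ℕ) (y : ℝ) => (((shellSet (p : ℝ)⁻¹ 1).indicator
                  (fun y => (y / Real.exp (δ / 2)) ^ n) y : ℝ) : ℂ))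
                (fun (n : ℕ) (y : ℝ) => (((shellSet (p : ℝ)⁻¹ 1).indicator
                  (fun y => (((p : ℝ) * Real.exp (δ / 2) * y) ^ n * y)⁻¹) y : ℝ) : ℂ)))
              (Sum.elim
                (fun (n : ℕ) (y : ℝ) => (((shellSet (p : ℝ)⁻¹ 1).indicator
                  (fun y => (y / Real.exp (δ / 2)) ^ n) y : ℝ) : ℂ))
                (fun (n : ℕ) (y : ℝ) => (((shellSet (p : ℝ)⁻¹ 1).indicator
                  (fun y => (((p : ℝ) * Real.exp (δ / 2) * y) ^ n * y)⁻¹) y : ℝ) : ℂ))) k y)))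
      ((shellSet ((p : ℝ)⁻¹ * Real.exp (-δ)) (Real.exp δ))ᶜ.indicator (fun _ => (1 : ℂ)) x *
        ((M : ℂ) * sincKernel (M * (x - y))) * (shellSet (p : ℝ)⁻¹ 1).indicator (fun _ => (1 : ℂ)) y) := by
  have h₁ := hasSum_sigmaPiece p hδ M 1 x y
  have h₂ := hasSum_sigmaPiece p hδ M (-1) x y
  refine hasSum_sum_of_pieces h₁ h₂ (fun j => rfl) (fun j => rfl) ?_
  by_cases hx : x ∈ (shellSet ((p : ℝ)⁻¹ * Real.exp (-δ)) (Real.exp δ))ᶜ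
  swap
  · rw [Set.indicator_of_notMem hx]; ring
  by_cases hy : y ∈ shellSet (p : ℝ)⁻¹ 1
  swap
  · rw [Set.indicator_of_notMem hy]; ring
  rw [Set.indicator_of_mem hx, Set.indicator_of_mem hy,
    dilatedSinc_eq_cexp_add hM (sub_ne_zero_of_separated p hδ hx hy)]
  ring

/-! ## §4. Bookkeeping: the coefficients have norm `1/(2π) ≤ 1` -/

omit hp in
/-- `|±σ i/(2π)| ≤ 1` for `|σ| = 1`. [cite: Connes1999, §VII proof of Thm 4 eqs. (29)–(33) (arXiv p0013)] -/
theorem norm_coeff_le_one {σ : ℝ} (hσ : |σ| = 1) :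
    ‖-(σ : ℂ) * I / (2 * π)‖ ≤ 1 ∧ ‖(σ : ℂ) * I / (2 * π)‖ ≤ 1 := by
  have h2π : ‖(2 * π : ℂ)‖ = 2 * π := by
    rw [show (2 * π : ℂ) = ((2 * π : ℝ) : ℂ) by push_cast; ring, Complex.norm_real, Real.norm_eq_abs,
      abs_of_pos (by positivity)]
  have hval : ‖(σ : ℂ) * I / (2 * π)‖ = 1 / (2 * π) := by
    rw [norm_div, norm_mul, Complex.norm_real, Complex.norm_I, Real.norm_eq_abs, hσ, h2π, mul_one]
  have hle : 1 / (2 * π) ≤ 1 := by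
    rw [div_le_one (by positivity)]; linarith [Real.pi_gt_three]
  refine ⟨?_, ?_⟩
  · rw [show -(σ : ℂ) * I / (2 * π) = -((σ : ℂ) * I / (2 * π)) by ring, norm_neg, hval]; exact hle
  · rw [hval]; exact hle

/-! ## §5. The operator expansion, packaged for the (S1,S0,S2) assembly -/

/-- **The rank-one expansion of the separated sinc operator `(1 − Q̃) P̂⁰_M Q₀`, packaged.**  For `δ > 0` there
are, over the countable index set `K = (ℕ ⊕ ℕ) ⊕ (ℕ ⊕ ℕ)`: coefficients `λ_k`, signs `σ_k ≠ 0`, base functions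
`u_k, w_k ∈ L²(ℝ)`, `M`-independent norms `ν_k = ‖u_k‖`, `ν'_k = ‖w_k‖` with `Σ_k |λ_k| (ν_k² + ν'_k²) < ∞`, and
modulated families `u_k^M =ᵐ e^{2πiσ_kM·} u_k`, `w_k^M =ᵐ e^{2πiσ_kM·} w_k` in `L²(ℝ)`, such that for every
`M > 0` and every `φ ∈ L²(ℝ)`:
`(1 − Q̃) P̂⁰_M Q₀ φ = Σ_k λ_k ⟨w_k^M, φ⟩ u_k^M` (norm-convergent) — `Q₀ = Q_{1/p,1}`, `Q̃ = Q_{e^{−δ}/p, e^δ}`.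
This is the NUCLEARITY of the separated remainder, uniform in the ultraviolet cutoff `M`. [cite: Connes1999, §VII eq. (13) and proof of Thm 4 eqs. (29)–(33) (arXiv p0013); ReedSimon1972, Thm. VI.23, PDF pp. 198–199] -/
theorem exists_rankOne_expansion_separatedSinc {δ : ℝ} (hδ : 0 < δ) :
    ∃ (lam : (ℕ ⊕ ℕ) ⊕ (ℕ ⊕ ℕ) → ℂ) (σ : (ℕ ⊕ ℕ) ⊕ (ℕ ⊕ ℕ) → ℝ) (u₀ w₀ : (ℕ ⊕ ℕ) ⊕ (ℕ ⊕ ℕ) → ℝ → ℂ)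
      (nu nw : (ℕ ⊕ ℕ) ⊕ (ℕ ⊕ ℕ) → ℝ) (u w : ℝ → (ℕ ⊕ ℕ) ⊕ (ℕ ⊕ ℕ) → Lp ℂ 2 (volume : Measure ℝ)),
      (∀ k, σ k ≠ 0) ∧ (∀ k, MemLp (u₀ k) 2 (volume : Measure ℝ)) ∧ (∀ k, MemLp (w₀ k) 2 (volume : Measure ℝ)) ∧
      (∀ M k, (u M k : ℝ → ℂ) =ᵐ[volume] fun x => cexp (2 * π * I * ((σ k * M * x : ℝ) : ℂ)) * u₀ k x) ∧
      (∀ M k, (w M k : ℝ → ℂ) =ᵐ[volume] fun x => cexp (2 * π * I * ((σ k * M * x : ℝ) : ℂ)) * w₀ k x) ∧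
      (∀ M k, ‖u M k‖ = nu k) ∧ (∀ M k, ‖w M k‖ = nw k) ∧
      (Summable fun k => ‖lam k‖ * (nu k ^ 2 + nw k ^ 2)) ∧
      ∀ M : ℝ, 0 < M → ∀ φ : Lp ℂ 2 (volume : Measure ℝ),
        HasSum (fun k => (lam k * ⟪w M k, φ⟫_ℂ) • u M k)
          ((((1 : Lp ℂ 2 (volume : Measure ℝ) →L[ℂ] Lp ℂ 2 (volume : Measure ℝ)) -
              shellProj ((p : ℝ)⁻¹ * Real.exp (-δ)) (Real.exp δ)) ∘L
            (dualCutoffProj ∅ M ∘L shellProj (p : ℝ)⁻¹ 1)) φ) := by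
  have hp0 : (0 : ℝ) < p := by exact_mod_cast hp.out.pos
  have hp1 : (1 : ℝ) ≤ p := by exact_mod_cast hp.out.one_lt.le
  have he : Real.exp (-δ) < 1 := Real.exp_lt_one_iff.mpr (by linarith)
  -- the data
  set bu : ℕ ⊕ ℕ → ℝ → ℂ := Sum.elim
    (fun (n : ℕ) (x : ℝ) => (({x : ℝ | Real.exp δ < |x|}.indicator (fun x => (Real.exp (δ / 2) / x) ^ n / x) x : ℝ) : ℂ))
    (fun (n : ℕ) (x : ℝ) => (({x : ℝ | |x| ≤ (p : ℝ)⁻¹ * Real.exp (-δ)}.indicator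
      (fun x => ((p : ℝ) * Real.exp (δ / 2) * x) ^ n) x : ℝ) : ℂ)) with hbu
  set bw : ℕ ⊕ ℕ → ℝ → ℂ := Sum.elim
    (fun (n : ℕ) (y : ℝ) => (((shellSet (p : ℝ)⁻¹ 1).indicator (fun y => (y / Real.exp (δ / 2)) ^ n) y : ℝ) : ℂ))
    (fun (n : ℕ) (y : ℝ) => (((shellSet (p : ℝ)⁻¹ 1).indicator
      (fun y => (((p : ℝ) * Real.exp (δ / 2) * y) ^ n * y)⁻¹) y : ℝ) : ℂ)) with hbw
  set u₀ : (ℕ ⊕ ℕ) ⊕ (ℕ ⊕ ℕ) → ℝ → ℂ := Sum.elim bu bu with hu₀def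
  set w₀ : (ℕ ⊕ ℕ) ⊕ (ℕ ⊕ ℕ) → ℝ → ℂ := Sum.elim bw bw with hw₀def
  set σ : (ℕ ⊕ ℕ) ⊕ (ℕ ⊕ ℕ) → ℝ := Sum.elim (fun _ => (1 : ℝ)) (fun _ => (-1 : ℝ)) with hσdef
  set lam : (ℕ ⊕ ℕ) ⊕ (ℕ ⊕ ℕ) → ℂ := Sum.elim
    (Sum.elim (fun _ : ℕ => -((1 : ℝ) : ℂ) * I / (2 * π)) (fun _ : ℕ => ((1 : ℝ) : ℂ) * I / (2 * π)))
    (Sum.elim (fun _ : ℕ => -((-1 : ℝ) : ℂ) * I / (2 * π)) (fun _ : ℕ => ((-1 : ℝ) : ℂ) * I / (2 * π))) with hlamdef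
  have hu₀ : ∀ k, MemLp (u₀ k) 2 (volume : Measure ℝ) := by
    rintro ((n | n) | (n | n))
    · exact (memLp_baseFamilies p δ n).1
    · exact (memLp_baseFamilies p δ n).2.2.1
    · exact (memLp_baseFamilies p δ n).1
    · exact (memLp_baseFamilies p δ n).2.2.1
  have hw₀ : ∀ k, MemLp (w₀ k) 2 (volume : Measure ℝ) := by
    rintro ((n | n) | (n | n))
    · exact (memLp_baseFamilies p δ n).2.1
    · exact (memLp_baseFamilies p δ n).2.2.2
    · exact (memLp_baseFamilies p δ n).2.1
    · exact (memLp_baseFamilies p δ n).2.2.2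
  have hU : ∀ (M : ℝ) k, MemLp (fun x => cexp (2 * π * I * ((σ k * M * x : ℝ) : ℂ)) * u₀ k x) 2
      (volume : Measure ℝ) := fun M k => memLp_cexp_mul (hu₀ k) (σ k * M)
  have hW : ∀ (M : ℝ) k, MemLp (fun x => cexp (2 * π * I * ((σ k * M * x : ℝ) : ℂ)) * w₀ k x) 2
      (volume : Measure ℝ) := fun M k => memLp_cexp_mul (hw₀ k) (σ k * M)
  -- the norm bounds
  have hσabs : ∀ k, |σ k| = 1 := by rintro ((n | n) | (n | n)) <;> simp [σ]
  have hlam : ∀ k, ‖lam k‖ ≤ 1 := by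
    rintro ((n | n) | (n | n))
    · exact (norm_coeff_le_one (σ := 1) (by simp)).1
    · exact (norm_coeff_le_one (σ := 1) (by simp)).2
    · exact (norm_coeff_le_one (σ := -1) (by simp)).1
    · exact (norm_coeff_le_one (σ := -1) (by simp)).2
  set C₁ : ℝ := ∫ x in {x : ℝ | Real.exp δ < |x|}, (|x| ^ 2)⁻¹ with hC₁
  have hC₁0 : 0 ≤ C₁ := setIntegral_nonneg (measurableSet_lt measurable_const continuous_abs.measurable) fun x _ => by positivity
  set B : ℝ := C₁ + 2 + 2 * (p : ℝ) ^ 2 with hB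
  have hbound : ∀ k, ‖(hu₀ k).toLp _‖ ^ 2 + ‖(hw₀ k).toLp _‖ ^ 2 ≤
      B * Real.exp (-δ) ^ (Sum.elim (Sum.elim id id) (Sum.elim id id) k : ℕ) := by
    have hr0 : ∀ n : ℕ, 0 ≤ Real.exp (-δ) ^ n := fun n => pow_nonneg (Real.exp_pos _).le n
    have hp2r : ∀ n : ℕ, 0 ≤ (p : ℝ) ^ 2 * Real.exp (-δ) ^ n := fun n => mul_nonneg (sq_nonneg _) (hr0 n)
    have hC₁r : ∀ n : ℕ, 0 ≤ C₁ * Real.exp (-δ) ^ n := fun n => mul_nonneg hC₁0 (hr0 n)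
    rintro ((n | n) | (n | n))
    · have h := norm_sq_baseFamilies_le p hδ n (hu₀ (Sum.inl (Sum.inl n))) (hw₀ (Sum.inl (Sum.inl n)))
        (hu₀ (Sum.inl (Sum.inr n))) (hw₀ (Sum.inl (Sum.inr n)))
      have h1 : ‖(hu₀ (Sum.inl (Sum.inl n))).toLp (u₀ (Sum.inl (Sum.inl n)))‖ ^ 2 ≤ Real.exp (-δ) ^ n * C₁ := h.1
      have h2 : ‖(hw₀ (Sum.inl (Sum.inl n))).toLp (w₀ (Sum.inl (Sum.inl n)))‖ ^ 2 ≤ 2 * Real.exp (-δ) ^ n := h.2.1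
      simp only [Sum.elim_inl, id]
      rw [hB]
      nlinarith [h1, h2, hr0 n, hp2r n, hC₁r n]
    · have h := norm_sq_baseFamilies_le p hδ n (hu₀ (Sum.inl (Sum.inl n))) (hw₀ (Sum.inl (Sum.inl n)))
        (hu₀ (Sum.inl (Sum.inr n))) (hw₀ (Sum.inl (Sum.inr n)))
      have h1 : ‖(hu₀ (Sum.inl (Sum.inr n))).toLp (u₀ (Sum.inl (Sum.inr n)))‖ ^ 2 ≤ 2 * Real.exp (-δ) ^ n := h.2.2.1
      have h2 : ‖(hw₀ (Sum.inl (Sum.inr n))).toLp (w₀ (Sum.inl (Sum.inr n)))‖ ^ 2 ≤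
          2 * (p : ℝ) ^ 2 * Real.exp (-δ) ^ n := h.2.2.2
      simp only [Sum.elim_inl, Sum.elim_inr, id]
      rw [hB]
      nlinarith [h1, h2, hr0 n, hp2r n, hC₁r n]
    · have h := norm_sq_baseFamilies_le p hδ n (hu₀ (Sum.inr (Sum.inl n))) (hw₀ (Sum.inr (Sum.inl n)))
        (hu₀ (Sum.inr (Sum.inr n))) (hw₀ (Sum.inr (Sum.inr n)))
      have h1 : ‖(hu₀ (Sum.inr (Sum.inl n))).toLp (u₀ (Sum.inr (Sum.inl n)))‖ ^ 2 ≤ Real.exp (-δ) ^ n * C₁ := h.1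
      have h2 : ‖(hw₀ (Sum.inr (Sum.inl n))).toLp (w₀ (Sum.inr (Sum.inl n)))‖ ^ 2 ≤ 2 * Real.exp (-δ) ^ n := h.2.1
      simp only [Sum.elim_inl, Sum.elim_inr, id]
      rw [hB]
      nlinarith [h1, h2, hr0 n, hp2r n, hC₁r n]
    · have h := norm_sq_baseFamilies_le p hδ n (hu₀ (Sum.inr (Sum.inl n))) (hw₀ (Sum.inr (Sum.inl n)))
        (hu₀ (Sum.inr (Sum.inr n))) (hw₀ (Sum.inr (Sum.inr n)))
      have h1 : ‖(hu₀ (Sum.inr (Sum.inr n))).toLp (u₀ (Sum.inr (Sum.inr n)))‖ ^ 2 ≤ 2 * Real.exp (-δ) ^ n := h.2.2.1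
      have h2 : ‖(hw₀ (Sum.inr (Sum.inr n))).toLp (w₀ (Sum.inr (Sum.inr n)))‖ ^ 2 ≤
          2 * (p : ℝ) ^ 2 * Real.exp (-δ) ^ n := h.2.2.2
      simp only [Sum.elim_inr, id]
      rw [hB]
      nlinarith [h1, h2, hr0 n, hp2r n, hC₁r n]
  have hgeom : Summable fun n : ℕ => B * Real.exp (-δ) ^ n :=
    (summable_geometric_of_lt_one (Real.exp_pos _).le he).mul_left B
  have hterm : ∀ k, ‖lam k‖ * (‖(hu₀ k).toLp _‖ ^ 2 + ‖(hw₀ k).toLp _‖ ^ 2) ≤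
      B * Real.exp (-δ) ^ (Sum.elim (Sum.elim id id) (Sum.elim id id) k : ℕ) := fun k =>
    calc ‖lam k‖ * (‖(hu₀ k).toLp _‖ ^ 2 + ‖(hw₀ k).toLp _‖ ^ 2)
        ≤ 1 * (‖(hu₀ k).toLp _‖ ^ 2 + ‖(hw₀ k).toLp _‖ ^ 2) :=
          mul_le_mul_of_nonneg_right (hlam k) (by positivity)
      _ ≤ B * Real.exp (-δ) ^ (Sum.elim (Sum.elim id id) (Sum.elim id id) k : ℕ) := by rw [one_mul]; exact hbound k
  have hsum : Summable fun k => ‖lam k‖ * (‖(hu₀ k).toLp _‖ ^ 2 + ‖(hw₀ k).toLp _‖ ^ 2) := by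
    refine Summable.of_nonneg_of_le (fun k => by positivity) hterm ?_
    refine Summable.sum _ (Summable.sum _ ?_ ?_) (Summable.sum _ ?_ ?_)
    all_goals simpa only [Function.comp_def, Sum.elim_inl, Sum.elim_inr, id] using hgeom
  refine ⟨lam, σ, u₀, w₀, fun k => ‖(hu₀ k).toLp _‖, fun k => ‖(hw₀ k).toLp _‖,
    fun M k => (hU M k).toLp _, fun M k => (hW M k).toLp _, ?_, hu₀, hw₀, ?_, ?_, ?_, ?_, hsum, ?_⟩
  · intro k
    have := hσabs k
    intro h0
    rw [h0, abs_zero] at this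
    exact zero_ne_one this
  · intro M k; exact (hU M k).coeFn_toLp
  · intro M k; exact (hW M k).coeFn_toLp
  · intro M k; exact norm_eq_of_ae_eq_cexp_mul (hu₀ k) (σ k * M) (hU M k).coeFn_toLp
  · intro M k; exact norm_eq_of_ae_eq_cexp_mul (hw₀ k) (σ k * M) (hW M k).coeFn_toLp
  · -- the operator expansion for `M > 0`
    intro M hM φ
    have hab : (p : ℝ)⁻¹ ≤ 1 := inv_le_one_of_one_le₀ hp1
    have hcd : (p : ℝ)⁻¹ * Real.exp (-δ) ≤ Real.exp δ := by
      have h1 : (p : ℝ)⁻¹ * Real.exp (-δ) ≤ 1 := by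
        calc (p : ℝ)⁻¹ * Real.exp (-δ) ≤ 1 * 1 := mul_le_mul hab he.le (Real.exp_pos _).le zero_le_one
          _ = 1 := mul_one _
      exact h1.trans (one_lt_exp_of_pos hδ).le
    have hK := memLp_separatedSinc p hδ hM
    have hT := fun φ : Lp ℂ 2 (volume : Measure ℝ) => separatedSinc_coeFn hM hab hcd φ
    have hnu : ∀ k, ‖(hU M k).toLp _‖ = ‖(hu₀ k).toLp _‖ := fun k =>
      norm_eq_of_ae_eq_cexp_mul (hu₀ k) (σ k * M) (hU M k).coeFn_toLp
    have hnw : ∀ k, ‖(hW M k).toLp _‖ = ‖(hw₀ k).toLp _‖ := fun k =>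
      norm_eq_of_ae_eq_cexp_mul (hw₀ k) (σ k * M) (hW M k).coeFn_toLp
    have hsum' : Summable fun k => ‖lam k‖ * (‖(hU M k).toLp _‖ * ‖(hW M k).toLp _‖) := by
      refine Summable.of_nonneg_of_le (fun k => by positivity) (fun k => ?_) hsum
      rw [hnu, hnw]
      refine mul_le_mul_of_nonneg_left ?_ (norm_nonneg _)
      nlinarith [sq_nonneg (‖(hu₀ k).toLp (u₀ k)‖ - ‖(hw₀ k).toLp (w₀ k)‖), norm_nonneg ((hu₀ k).toLp (u₀ k)),
        norm_nonneg ((hw₀ k).toLp (w₀ k))]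
    have hker := hasSum_separatedSinc_kernel p hδ hM
    exact hasSum_rankOne_of_kernel_expansion hK hT (hU M) (hW M) hsum' hker φ

end Literature.NumberTheory.Connes2026
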